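import Mathlib
import HarnessLib
import HarnessLib.Audit
import Summits.AtomisticToContinuum.Statement
import Literature.MathematicalPhysics.QuantumManyBody.PeriodicBoseGas

/-!
Route: BECSwapAffinity

CLOSED (retired) 2026-08-15T13:40:50Z by operator:999:1257524 — reason: not-a-thesis: assembly does not conclude the sub-problem Statement — note: D-0027 §2.1 audit (human 2026-08-15: routes that do not decide the summit are removed): the assembly concludes `Literature.MathematicalPhysics.QuantumManyBody.BoseGas.BoseEinsteinCondensation`, not the sub-problem statement; a NEW conforming route may be opened from the same idea (generated `closes . The file is kept as the record of this route; refuted decls are indexed as negative knowledge (`ledger negatives`).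

# Route BECSwapAffinity — BEC from a bounded accessible swap entropy (insertion log-amplitude
variance) of the positive ground state

Realises card AtomisticToContinuum/BoseEinsteinCondensation/swap-affinity-insertion-variance. Put
μ_Ψ = |Ψ|²dX on Λ^N and let T swap
coordinate i between two independent copies, p = dμ⊗μ/dZ, q = p∘T. Exact identity (Ψ ≥ 0):
tr(γ_Ψ²)/N² = ∫√(pq) = Bhattacharyya
affinity of μ⊗μ and T_*(μ⊗μ); P–O (5): λ_max(γ) ≥ tr γ²/N; truncated Jensen on the accessible set G
= {q ≠ 0}:
∫√(pq) ≥ P(G)·exp(−D_acc/(2P(G))) with D_acc = ∫_G p log⁺(p/q) (accessible swap relative entropy =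
mean excess insertion
log-amplitude of a boson teleported to an independent position; finite for hard cores). It suffices
to show X_A =
InsertionEntropyBound: for every repulsive finite-range v and all small ρ there is C such that for
all large N, every i and EVERY
slack δ > 0 SOME nonnegative δ-near-minimiser Ψ of the Dirichlet energy at L = (N/ρ)^{1/3} has P(G)
≥ 1/2 and D_acc(Ψ) ≤ C
(existential typing models the Perron–Frobenius ground state without operators; ∀-typing over
near-minimisers is refutable by
cheap finite-N witnesses, item UniversalEntropyBoundFails). Then λ_max ≥ (N/2)e^{−C} for those Ψ
(SwapJensen, TraceSqLower),
GroundStateRigidity (shared with the sibling positivity routes; via NearMinimiserStability)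
transfers the bound to all near-minimisers of small slack, le_condensateNumber gives
HasGroundStateBEC,
hence BoseEinsteinCondensation. The cruxes are the card's R/H/L decomposition of "D_acc = O(1)":
local log-Harnack at the healing
scale (UV), hyperuniformity S_N(k) ≤ C|k|/√(ρa) (IR input), and the linear-response bookkeeping
turning H ∧ L into the entropy bound.
Lean: `∀ v : ℝ → ENNReal,
Literature.MathematicalPhysics.QuantumManyBody.BoseGas.IsRepulsiveFiniteRange v → ∃ ρ₀ : ℝ, 0 < ρ₀ ∧
∀ ρ : ℝ, 0 < ρ → ρ < ρ₀ → ∃ C : ℝ, ∀ᶠ N : ℕ in Filter.atTop, ∀ i : Fin N, ∀ δ : ENNReal, 0 < δ → ∃ Ψ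
: Literature.MathematicalPhysics.QuantumManyBody.BoseGas.TrialState N
(Literature.MathematicalPhysics.QuantumManyBody.BoseGas.sideLength ρ N),
Literature.MathematicalPhysics.QuantumManyBody.BoseGas.energy v Ψ ≤
Literature.MathematicalPhysics.QuantumManyBody.BoseGas.groundStateEnergy v N
(Literature.MathematicalPhysics.QuantumManyBody.BoseGas.sideLength ρ N) + δ ∧ (∀ X, Ψ.ψ X = (‖Ψ.ψ X‖
: ℂ)) ∧ (let p : Literature.MathematicalPhysics.QuantumManyBody.BoseGas.Config N ×
Literature.MathematicalPhysics.QuantumManyBody.BoseGas.Config N → ℝ := fun Z => ‖Ψ.ψ Z.1‖ ^ 2 * ‖Ψ.ψ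
Z.2‖ ^ 2; let q : Literature.MathematicalPhysics.QuantumManyBody.BoseGas.Config N ×
Literature.MathematicalPhysics.QuantumManyBody.BoseGas.Config N → ℝ := fun Z => ‖Ψ.ψ
(Function.update Z.1 i (Z.2 i))‖ ^ 2 * ‖Ψ.ψ (Function.update Z.2 i (Z.1 i))‖ ^ 2; (1 / 2 : ENNReal)
≤ (∫⁻ Z in {Z | q Z ≠ 0}, ENNReal.ofReal (p Z)) ∧ (∫⁻ Z in {Z | q Z ≠ 0}, ENNReal.ofReal (p Z *
(Real.log (p Z) - Real.log (q Z)))) ≤ ENNReal.ofReal C)`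

## Assembly
Pure logic plus the supports: from GroundStateHyperuniformity (∃δ_H ∀), LocalLogHarnack (∀δ ∃) and
InsertionEntropyFromStructure
(∀ C_H C_L ∃ C … (∀…) → (∃…) → ∃…) one gets InsertionEntropyBound by taking δ' = min(δ, δ_H)
(kernel-checked in the planner's
Sketch.lean, theorem target_of_cruxes); then TargetToBEC (SwapJensen + TraceSqLower +
NearMinimiserStability + le_condensateNumber)
with GroundStateRigidity. GroundStateEnergyFinite is used inside the proofs of the ∀-typed crux and
of rigidity, not as a hypothesis here.

Rationale: WHY THIS LINE. Positivity of the Dirichlet ground state is structural information no energy-window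
method uses, and the swap-affinity identity
(HerdmanEtAl2014 / HastingsEtAl2010 estimator; PenroseOnsager1956 §4 (5)–(7)) turns
thermodynamic-limit BEC into a statement about ONE
scalar field, the insertion log-amplitude x ↦ −2 log Ψ₀(x, X̂): bounded accessible relative entropy
⇒ condensate fraction ≥ ½e^{−C},
mode-free (tr γ², so Dirichlet wall layers and generalized condensation are harmless). For
pair-product states this is Reatto1969 /
Chester1970 / GirvinMacdonald1987 (bounded half-strength test-particle free energy ⇔ ODLRO); the
route transfers it to the TRUE ground
state through a multiscale variance decomposition: scales ≤ ξ = (ρa)^{−1/2} by a one-variable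
log-Harnack property (crux L), scales ≫ ξ
by linear response of log Ψ₀ to long-wavelength density waves with a C/|k| symbol (ReattoChester1967
phonon tail) against a
hyperuniform structure factor S_N(k) = O(|k|/√(ρa)) (crux H, PitaevskiiStringari1991 Schwarz
inequality + a static-response energy
bound in the FournaisSolovej2020 technology): Var ≈ ρ∫|ĥ|²S d³k has integrand ∝ k^{d−2}, convergent
in d = 3 and log-divergent in
d = 1, where it reproduces Lenard1964's n₀ ≍ √N (ForresterEtAl2003). Imported areas: information
inequalities (Bhattacharyya/KL,
Jensen), hyperuniformity of point processes (TorquatoStillinger2003), linear response. Versus the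
four existing routes (all
energy-currency: IR bound on n_k, periodic reduction, κ/L² pinning, functional RG) this line never
converts an energy window into
depletion and never uses a kinetic gap; negatives index empty at filing.

RANKED CRUXES. #0 InsertionEntropyBound (target) — X_A. For every repulsive finite-range v there is
ρ₀ > 0 such that for 0 < ρ < ρ₀ there is C with: for all large N, every coordinate i and every δ > 0
some δ-near-minimiser Ψ of the Dirichlet N-body energy in the box of side (N/ρ)^{1/3} is real
nonnegative and has accessible mass P_{μ⊗μ}(q ≠ 0) ≥ 1/2 and accessible swap entropy ∫_{q≠0} p
log⁺(p/q) ≤ C, where p(X,Y) = Ψ(X)²Ψ(Y)² and q = p after swapping x_i ↔ y_i. Strictly stronger than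
BEC (KL-type; audit of card palm-density-integrability-ladder), equivalent in spirit to 'the work to
teleport one atom has bounded mean'. (why it might fail: KL-type bound is strictly stronger than
BEC: rare heavy local clusters in Ψ₀² could make D_acc grow while tr γ² stays ≥ cN²; the d = 1
analogue fails (Δ_N ~ ½ log N) and d = 3 convergence of ∫k^(d−2)dk is the bet.) [PenroseOnsager1956,
Reatto1969, HerdmanEtAl2014, GirvinMacdonald1987, Lenard1964]
#2 InsertionEntropyFromStructure (crux) — (crux R of the card + the variance bookkeeping, typed as
one implication so that all three cruxes talk about the same witness) For v, small ρ and ANY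
constants C_H, C_L there is C such that for large N, every i and every δ > 0: IF every
δ-near-minimiser is C_H-hyperuniform in the window 2π/L ≤ |k| ≤ √(ρa) (body of
GroundStateHyperuniformity) AND some nonnegative δ-near-minimiser has accessible one-variable
log-oscillation ≤ C_L at displacement scale ξ = (ρa)^{−1/2} (body of LocalLogHarnack), THEN some
nonnegative δ-near-minimiser has accessible mass ≥ 1/2 and accessible swap entropy ≤ C (body of
InsertionEntropyBound). Intended proof: D_acc ≤ E_X̂[⟨U⟩_n,acc − ⟨U⟩_{p_X̂}] = ∫₀¹ E Var_{p_t}(U)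
dt; split Var at scale ξ; UV part from the L-hypothesis; IR part Σ_{|k|≤1/ξ} |Û_X̂(k)|² with the
LINEAR-RESPONSE STRUCTURE Û_X̂(k) = ĥ(k)ρ̂_X̂(k) + r_X̂(k), |ĥ(k)| ≤ C/|k|, E|r|² summable, so that
E Σ|ĥ|²|ρ̂|²/V² ≤ (C_H/ρ)∫_{|k|≤√(ρa)} k^{-2}·k/√(ρa) d³k = O(C_H √(ρa³)·const): the k^{d−2}
integrand. [deps: GroundStateHyperuniformity, LocalLogHarnack] [difficulty: XL] (why it might fail:
Needs log Ψ₀ to respond LINEARLY to long-wavelength density waves with a C/|k| symbol and a summable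
remainder; genuine many-body (three-phonon, marginal in 3+1 D) terms of the insertion field could
carry extra IR weight — the Reatto–Chester 1/r² tail is heuristic.) [ReattoChester1967, Reatto1969,
Chester1970, GirvinMacdonald1987,
Literature.Barriers.AtomisticToContinuum.BogoliubovPerturbationInfrared, Griffin1993]
#3 GroundStateHyperuniformity (crux) — (crux H) For every repulsive finite-range v there are ρ₀, C
such that for 0 < ρ < ρ₀ and all large N there is δ > 0 with: every δ-near-minimiser Ψ (Dirichlet, L
= (N/ρ)^{1/3}, complex allowed — the functional is |Ψ|²-robust) has, for every k = (2π/L)m, m ∈ ℤ³∖0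
with |k| ≤ √(ρa) (a = scattering length; empty window for v ≡ 0), Var_{|Ψ|²}(Σ_j e^{ik·x_j}) ≤
C·N·|k|/√(ρa), i.e. S_N(k) ≤ C|k|/√(ρa) uniformly down to the lowest mode (Bogoliubov: S =
k/√(k²+16πρa), C → 1/(4√π)). Route to it: Onsager–Price/Pitaevskii–Stringari Schwarz inequality S(k)
≤ |k|√(χ_N(k)/N) for near-minimisers plus a static-response bound χ_N(k)/N ≤ C'/(ρa) from a
second-order (LHY-precision, inhomogeneous) energy LOWER bound for H_N + λΣ_i cos(k·x_i).
[difficulty: XL] (why it might fail: Uniformity down to |k| = 2π/L in a DIRICHLET box for all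
near-minimisers rests on a static-response energy lower bound at LHY precision with a cos-probe that
is not in print; wall layers / the canonical constraint could spoil the lowest modes; C might need
ρ-dependence.) [PitaevskiiStringari1991, FournaisSolovej2020, Fournais2020, TorquatoStillinger2003,
LSSY2005, Literature.Barriers.AtomisticToContinuum.KineticGapLengthScales]
#4 LocalLogHarnack (crux) — (crux L) For every repulsive finite-range v there are ρ₀, C such that
for 0 < ρ < ρ₀, all large N, every i and every δ > 0 some nonnegative δ-near-minimiser Ψ satisfies,
with r = (ρa)^{−1/2}, B = ball(0,r) and X^{i,h} = X with x_i ↦ x_i + h: (a) inaccessible displaced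
mass ∫_B P_{X∼Ψ²}(Ψ(X^{i,h}) = 0) dh ≤ |B|/4 and (b) accessible log-oscillation ∫_B E_{X∼Ψ²}[|log
Ψ²(X) − log Ψ²(X^{i,h})|; Ψ(X^{i,h}) ≠ 0] dh ≤ C|B| — one-variable log-Harnack at the healing scale,
μ-typically and in first moment (not pointwise: ~(ρa³)^{−1/2} neighbours sit within ξ, but only
fluctuations of Σ_j u(x−x_j) enter, of variance O(√(ρa³))). Intended proof: Feynman–Kac /
ground-state-transformed diffusion of the tagged particle over time ξ², coupling; or Moser–Harnack
for the one-variable conditional amplitude with the frozen environment as a potential. [difficulty: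
L] (why it might fail: The first moment of the one-variable log-oscillation at scale ξ must be O(1)
uniformly in N although ~(ρa³)^(−1/2) neighbours lie within ξ; near-wall and near-core
log-singularities must stay integrable; the tagged-particle coupling argument is heuristic.)
[ReedSimonIV1978, Reatto1969, ReattoChester1967, LiebSeiringerSolovejYngvason2005, McMillan1965]
#5 GroundStateRigidity (crux) — (∃→∀ transfer, SHARED verbatim with routes BECPalmLandscape /
BECConditionalEntropy = item stmt-AtomisticToContinuum-3298, so one proof serves every positivity
route) For every repulsive finite-range v, small ρ, all large N and every η > 0 there is δ > 0 such
that any two δ-near-minimisers Ψ, Φ of the Dirichlet energy at L = (N/ρ)^(1/3) satisfy ∫|Ψ − cΦ|² ≤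
η for some unit complex c. Content: E₀ < ∞ (GroundStateEnergyFinite), L²-precompactness of energy
sublevel sets at fixed N (Rellich), UNIQUE positive ground state (Perron–Frobenius for finite v; for
hard cores: near-minimal energy concentrates on ONE H¹-component of the hard-sphere free region).
With the L²-Lipschitz continuity of maxOccupation it yields NearMinimiserStability (support), which
is what TargetToBEC consumes. [difficulty: L] (why it might fail: Needs a UNIQUE ground state at
fixed N: automatic for finite v (positivity improving), but for hard cores the N-sphere free region
in Λ_L is disconnected for large L (sparse locally jammed packings exist at any density), so caged
components must be excluded by an energy argument.) [ReedSimonIV1978, BaryshnikovBubenikKahle2013,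
Kahle2012, LiebSeiringerSolovejYngvason2005, route-AtomisticToContinuum-BECPalmLandscape]
#9 SwapJensen (support) — (identity + truncated Jensen, card item 1) For every real nonnegative
trial state Ψ of N = n+1 bosons, θ > 0 and C: if the accessible mass at coordinate 0 is ≥ θ and the
accessible swap entropy is ≤ C then the swap purity ∫∫ |∫Ψ(x,X̂)Ψ(x,Ŷ)dx|² dX̂dŶ (= tr γ²/N² =
∫√(pq)) is ≥ θ·exp(−C/(2θ)). Proof: ∫√(pq) = E_P[√(q/p); G], Jensen for log on the conditional law
P(·|G), log⁺ ≥ log, monotonicity of M ↦ M e^(−D/(2M)); Tonelli to identify the K-form with ∫√(pq)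
(Matrix.vecCons ↔ Function.update at 0). [difficulty: M] [PenroseOnsager1956, HerdmanEtAl2014]
#9 TraceSqLower (support) — (Penrose–Onsager (5), variational form) For every trial state Ψ of n+1
bosons (complex allowed): (n+1)·∫∫|∫Ψ(x,X̂)conjΨ(x,Ŷ)dx|² dX̂dŶ ≤ maxOccupation (n+1) Ψ, i.e. tr γ²
≤ N λ_max(γ). Operator-free proof: with the normalised modes φ_Ŷ = Ψ(·,Ŷ)/‖Ψ(·,Ŷ)‖ and weights w(Ŷ)
= ‖Ψ(·,Ŷ)‖², occupation N φ_Ŷ Ψ = N∫|K(X̂,Ŷ)|²dX̂ / w(Ŷ), and a w-average of occupations is ≤ their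
supremum (Tonelli; measurability of φ_Ŷ from continuity of Ψ). [difficulty: M] [PenroseOnsager1956,
LSSY2005]
#9 SwapPurityImpliesBEC (support) — (mode-free frame, shared with cards swap-overlap-no-catastrophe
S2 / rigidity-tolerance X_C) If for every v, small ρ, some c > 0, all large n some δ > 0 makes every
δ-near-minimiser of n+1 bosons have swap purity ≥ c, then BoseEinsteinCondensation. Proof:
TraceSqLower gives maxOccupation ≥ c(n+1); le_condensateNumber; index shift N = n+1. [difficulty: S]
[PenroseOnsager1956, LiebSeiringerSolovejYngvason2005]
#9 TargetToBEC (support) — (frame #1: X_A → statement, given the transfer) InsertionEntropyBound →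
GroundStateRigidity → BoseEinsteinCondensation. Proof: for N = n+1 large and every δ the target
witness has purity ≥ ½e^(−C) (SwapJensen with θ = 1/2, i = 0), hence maxOccupation ≥ (N/2)e^(−C)
(TraceSqLower); NearMinimiserStability (from GroundStateRigidity) gives δ₀ with maxOccupation ≥
(N/4)e^(−C) for all δ₀-near-minimisers; le_condensateNumber; c = e^(−C)/4. The planner's Sketch.lean
proves GroundStateHyperuniformity → LocalLogHarnack → InsertionEntropyFromStructure →
InsertionEntropyBound by pure logic (δ' = min δ δ_H), so this item plus that lemma is the Assembly.
[difficulty: S] [PenroseOnsager1956, LiebSeiringerSolovejYngvason2005]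
#9 GroundStateEnergyFinite (support) — (shared with route BECPinning,
stmt-AtomisticToContinuum-0850, same signature) for repulsive finite-range v there is ρ₀ > 0 such
that for ρ < ρ₀ and all large N the Dirichlet ground-state energy at L = (N/ρ)^(1/3) is finite (N
disjoint symmetric C¹ bumps at mutual distance > R₀). Needed so that 'δ-near-minimiser' is not
vacuous in the ∀-typed cruxes. [difficulty: provable-now] [LiebSeiringerSolovejYngvason2005]
#9 NearMinimiserStability (support) — (the form of the transfer the frame uses) GroundStateRigidity
→ for every v, small ρ and all large N: if for every δ > 0 SOME δ-near-minimiser has maxOccupation ≥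
m, then for some δ > 0 EVERY δ-near-minimiser has maxOccupation ≥ m/2. Proof from rigidity with η ~
(m/(8N))² and the √N-Lipschitz bound maxOccupation(Ψ)^(1/2) ≤ maxOccupation(Φ)^(1/2) + √N‖Ψ − cΦ‖₂
(sup over modes of item stmt-AtomisticToContinuum-3300 OccupationStability of route
BECPalmLandscape); m ≤ N is forced by the hypothesis. [difficulty: provable-now]
[LiebSeiringerSolovejYngvason2005, route-AtomisticToContinuum-BECPalmLandscape]
#9 UniversalEntropyBoundFails (support) — (negative side; certifies the existential typing of X_A)
It is FALSE that for all v, small ρ, some C, all large N, some δ > 0, EVERY nonnegative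
δ-near-minimiser has accessible mass ≥ 1/2 and accessible swap entropy ≤ C. Witness v ≡ 0: multiply
a nonnegative C¹ near-minimiser by flat pair cut-offs Π_(i<j)(1 − χ_ε(x_i − x_j)) (χ_ε = 1 on a ball
of radius ε, 1 − χ_ε vanishing to infinite order at |x| = 2ε): the energy excess → 0 as ε → 0 at
fixed N while p log⁺(p/q) is non-integrable at the artificial contact surface, so D_acc = ⊤ for
near-minimisers of every slack. [difficulty: L] [PenroseOnsager1956,
LiebSeiringerSolovejYngvason2005]

TWO-LAYER PLAN. Foreseen glued splits (nothing filed now; k ≤ 3, depth 1):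
InsertionEntropyFromStructure ⇐ ResponseSymbolBound (|ĥ(k)| ≤ C/|k| for the long-wavelength response
of the accessible insertion field of near-minimisers) → RemainderSummable (E Σ_(|k|≤1/ξ) |r_X̂(k)|²
≤ C) → VarianceToEntropy (D_acc ≤ ∫₀¹ E Var_(p_t) dt bookkeeping with the accessible truncation, a
deterministic inequality for nonnegative trial states) → InsertionEntropyFromStructure.
GroundStateHyperuniformity ⇐ SchwarzSumRule (S_N(k)² ≤ k²·χ_N(k)/N for near-minimisers:
Onsager–Price/Pitaevskii–Stringari from the double commutator, uses minimality beyond the value E₀)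
→ StaticResponseBound (χ_N(k)/N ≤ C/(ρa) for 2π/L ≤ |k| ≤ √(ρa): second-order energy lower bound for
H_N + λΣcos(k·x_i), λ in the window (ρa³)^(1/4)ρa ≪ λ ≪ ρa) → GroundStateHyperuniformity.
GroundStateRigidity ⇐ GroundStateUnique (one H¹-component carries all near-minimal energy; PF) →
SublevelCompact (Rellich at fixed N) → GroundStateRigidity (split owned jointly with routes
BECPalmLandscape / BECConditionalEntropy, which share the item).
Periodic (torus) variants of H and L are natural first children if the Dirichlet wall layer
obstructs: the whole chain is mode-free, so a torus version plugs into route BECPeriodicReduction's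
BoundaryTransferWeak instead.

KILL CRITERIA. A refutation of InsertionEntropyBound for some admissible v at arbitrarily small ρ
closes the route (close --reason refuted:InsertionEntropyBound); the conjunct survives (the
criterion is strictly stronger than BEC). A refutation of GroundStateHyperuniformity (e.g. S_N at
the lowest Dirichlet modes ≳ const) forces a pivot: restate H as the AVERAGED bound Σ_(|k|≤√(ρa))
S_N(k)/|k|² ≤ C·L³√(ρa)·ρ^(…) that the bookkeeping actually consumes, or move H to the torus. A
refutation of LocalLogHarnack in first moment → restate at scale c·ξ or in quantile form. A
refutation of GroundStateRigidity can only come from hard cores (degenerate ground states by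
caging): pivot to 'v finite a.e.' + a separate hard-core transfer item (jointly with the two sibling
routes that share it). If SwapPurity ≥ c (≡ BEC) is proved by another route, this route is
superseded. InsertionEntropyFromStructure refuted with H and L standing = the linear-response
picture of log Ψ₀ is wrong in the IR: close the route, census to the RG route (BECRenormGroup) whose
Ward identities are then the only remaining handle.

NOT DECOMPOSED YET. The internal structure of crux R (symbol bound / remainder / variance→entropy
bookkeeping, see Two-layer plan), the two halves of crux H (Schwarz sum rule, static-response energy
bound) and of the rigidity transfer (uniqueness, compactness) are deliberately NOT filed: they are
layer-2 children once a crux closes or a prover proposes the split. Constants (C_H → 1/(4√π), the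
√(ρa³) size of D_acc), the periodic variants, the v ≡ 0 degenerate case (a = 0: H and L vacuous,
target true with D_acc = 0 for product states) and positive temperature are left inside proofs. No
definition is load-bearing: swap purity, accessible entropy and the structure-factor variance are
inlined with `let`; definition requests below are hygiene.

CHEAPEST FALSIFIER. (1) Pair-product check (paper, one page): for Ψ_J = Π f(x_i − x_j) with f the
zero-energy scattering solution healed at ξ, the accessible swap entropy is D_acc = E_ν[U; acc] −
E_μ[U] + O(1) with U = Σ_j u(x − x_j); cluster/HNC leading order gives −ρ∫(e^(−u) − 1)u − ρ∫u·(g −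
1) = C√(ρa³) + O(ρR₀³‖u‖_∞), N-independent (Reatto1969's μ_ex computation) — if instead it grows
with N (log N as in d = 1) the line is dead already at the Jastrow level. (2) v ≡ 0: the free
Dirichlet ground state is a product, p = q, D_acc = 0, P(G) = 1; H and L windows are empty — every
item must be (and is) consistent with a = 0. (3) Numerics a refuter can run: PIGS swap estimator of
tr γ²/N² and of D_acc for hard spheres at ρa³ = 10⁻³, N = 64…512 (HerdmanEtAl2014 estimator): D_acc
must be flat in N (≈ 1.5√(ρa³) ≈ 0.05). (4) Lowest-mode structure factor of a Dirichlet-box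
Bogoliubov ground state (explicit quadratic form): S_N(2π/L) must be O(1/(L√(ρa))), not O(1) — kills
H's 'down to 2π/L' if the wall layer contributes O(1).

NUMBERS. Bogoliubov (ħ = 2m = 1): ε(k) = √(k⁴ + 16πρa k²), S(k) = k²/ε(k) = k/√(k² + 16πρa) ≤
k/(4√(πρa)), so C_H ≈ 0.141; healing length ξ = (8πρa)^(−1/2); depletion 1 − n₀/N = (8/(3√π))√(ρa³)
≈ 1.505√(ρa³); leading D_acc ≈ Δ_N ≈ const·√(ρa³) (card: Bogoliubov-depletion order); hard spheres
at ρa³ = 10⁻³: condensate fraction ≈ 0.95, accessible-mass loss 2·(4π/3)ρa³ ≈ 0.008; LHY: e₀ =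
4πρa(1 + (128/(15√π))√(ρa³)) (FournaisSolovej2020 lower bound). d = 1 contrast: Δ_N ≍ ½ log N, n₀ ≍
√N (Lenard1964, ForresterEtAl2003).

DEFINITION REQUESTS. Hygiene only (statements inline them with `let`): BoseGas.swapPurity N Ψ := ∫⁻
(X̂,Ŷ), ‖∫ x, Ψ(x::X̂)·conj Ψ(x::Ŷ)‖₊² (= tr γ²/N², the one-body purity / two-copy swap
expectation); BoseGas.structureFactorVar N L Ψ m := ⨅ c, ∫⁻ ‖Σ_j e^(ik·x_j) − c‖₊²|Ψ|² (N·S_N(k), k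
= (2π/L)m); BoseGas.accessibleSwapEntropy / accessibleSwapMass (D_acc, P(G) at coordinate i). Topic
Literature/MathematicalPhysics/QuantumManyBody. Filed after open as definition items for the target.

Novelty: Searches (2026-08-15, this seat): `lit search --hybrid "swap estimator one-body density matrix Renyi
entropy condensate fraction path integral ground state"` (12 textbook hits, none with an
inequality); `lit search --source crossref "structure factor dilute Bose gas ground state rigorous
bound density response Bogoliubov"` (15: energy bounds only — LeeYin2010, ErdősSchleinYau2008,
BastiCenatiempoSchlein2021, FournaisNapiórkowskiReuvers2019); `lit galaxy search "condensate
fraction test particle chemical potential Jastrow" --star all` (0 hits); OpenAlex 429 (daily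
budget). Plus the card's three refuter novelty audits (audit-1, -14, -16, all NEW-COMBINATION) whose
searches I rely on: crossref/zbMATH/hybrid for Herdman–Del Maestro swap estimators,
Reatto/Chester/Girvin–MacDonald insertion criteria, Torquato–Stillinger hyperuniformity (zbMATH
'hyperuniform ground state bosons structure factor': 0; 'one-body reduced density matrix purity
condensate fraction bound': 0).
Nearest prior art found: HerdmanEtAl2014 (doi:10.1103/physrevb.89.140501) and HerdmanDelmaestro2015
(doi:10.1103/physrevb.91.184507): tr γ²/N² as the two-replica one-particle SWAP estimator, bounded
by n₀ (numerics, 1-D log N side) — the identity is in print; HastingsEtAl2010 (swap trick);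
Reatto1969 (doi:10.1103/physrev.183.334), Chester1970, GirvinMacdonald1987: for PAIR-PRODUCT states
n₀ = exp(μ_ex[u] − 2μ_ex[u/2]) > 0 iff the half-strength test particle has bounded excess free
energy (classical analogy, not the  [refs: 10.1103/physrevb.89.140501, 10.1103/physrevb.91.184507, 10.1103/physrev.183.334, doi:10.1103/physrevb.89.140501, doi:10.1103/physrevb.91.184507, doi:10.1103/physrev.183.334, HerdmanEtAl2014, HerdmanDelmaestro2015, HastingsEtAl2010, Reatto1969, Chester1970, GirvinMacdonald1987, PenroseOnsager1956, PitaevskiiStringari1991, TorquatoStillinger2003]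

Barriers (technique_class: positivity, entropy-inequality, hyperuniformity, response): - technique_class: positivity, entropy-inequality, hyperuniformity, response
- Literature.Barriers.AtomisticToContinuum.KineticGapLengthScales: evaded — no step bounds depletion
by (box side)² × energy excess; the target is λ_max via tr γ² and positivity, which the narrowed
block (KineticGapLengthScalesNarrow, 2026-08-15) lists as OUTSIDE the bound energy-window class
('λ_max-targets', 'positivity Ψ₀ > 0 plus repulsion: open exit'); L enters only through |k| ≥ 2π/L
in a convergent k-sum. Honest caveat: crux H's intended proof uses a second-order energy lower bound
— for a RESPONSE coefficient at fixed k, not for depletion, so no L² loss is incurred; if a prover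
routes H through box localisation with a gap the barrier re-enters there.
- Literature.Barriers.AtomisticToContinuum.EnergyAsymptoticsWithoutCondensation: evaded by design —
the input is the law of the positive ground state (log Ψ₀), not e₀(ρ) to two orders; the 1-D
Lieb–Liniger/Tonks witness is reproduced correctly (log-correlated insertion field ⇒ Δ_N ~ ½ log N ⇒
no BEC), and the narrowed block exempts d = 3-specific IR-summability inferences, which is exactly
the k^(d−2) test.
- Literature.Barriers.AtomisticToContinuum.BogoliubovPerturbationInfrared: only STATIC,
gauge-invariant objects enter (S_N(k), the density-response symbol ĥ(k)); the narrowed block records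
that n_0 and static response are 'not sensitive to the Ginzburg scale'; the honest re-entry point is
crux R (rank 2): the remainder r_X̂(k) of the linear-re

History (route lifecycle, newest last):
- 2026-08-15T12:21:31Z · BROKEN — SwapJensen (stmt-AtomisticToContinuum-3980, support) refuted by Summit.AtomisticToContinuum.BoseEinsteinCondensation.Theorems.BECSwapAffinitySwapJensen_refuted (refuter-refute-pool-g40-7)
- 2026-08-15T13:40:50Z · CLOSED retired — not-a-thesis: assembly does not conclude the sub-problem Statement (operator:999:1257524)

sub-problem: BoseEinsteinCondensation · status: closed(retired) · opened planner-plancard-AtomisticToContinuum-BoseEin-554a7d6f-0 2026-08-15T11:26:49Z · rev 0 · ledger route-AtomisticToContinuum-BECSwapAffinity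
GENERATED by the gate from the ledger (D-0016/17). Provers cite these decls: `theorem foo : Summit.AtomisticToContinuum.BoseEinsteinCondensation.Theses.BECSwapAffinity.<Decl> := …` in Summits/AtomisticToContinuum/BoseEinsteinCondensation/Theorems/<Name>.lean.
-/

namespace Summit.AtomisticToContinuum.BoseEinsteinCondensation.Theses.BECSwapAffinity

open scoped BigOperators Topology Manifold Classical MeasureTheory ProbabilityTheory Matrix InnerProductSpace ComplexConjugate ContinuousMap
open Filter Set Function TopologicalSpace MeasureTheory

attribute [summit_statement] _root_.BoseEinsteinCondensation

/-- item stmt-AtomisticToContinuum-3976 · target · rank 0 · closed · moot by None · by planner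
why it might fail: KL-type bound is strictly stronger than BEC: rare heavy local clusters in Ψ₀² could make D_acc grow while tr γ² stays ≥ cN²; the d = 1 analogue fails (Δ_N ~ ½ log N) and d = 3 convergence of ∫k^(d−2)dk is the bet.
sources: PenroseOnsager1956, Reatto1969, HerdmanEtAl2014, GirvinMacdonald1987, Lenard1964
[target] X_A. For every repulsive finite-range v there is ρ₀ > 0 such that for 0 < ρ < ρ₀ there is C
with: for all large N, every coordinate i and every δ > 0 some δ-near-minimiser Ψ of the Dirichlet
N-body energy in the box of side (N/ρ)^{1/3} is real nonnegative and has accessible mass P_{μ⊗μ}(q ≠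
0) ≥ 1/2 and accessible swap entropy ∫_{q≠0} p log⁺(p/q) ≤ C, where p(X,Y) = Ψ(X)²Ψ(Y)² and q = p
after swapping x_i ↔ y_i. Strictly stronger than BEC (KL-type; audit of card
palm-density-integrability-ladder), equivalent in spirit to 'the work to teleport one atom has
bounded mean'. -/
@[route_item "route-AtomisticToContinuum-BECSwapAffinity"]
def InsertionEntropyBound : Prop :=
  ∀ v : ℝ → ENNReal, Literature.MathematicalPhysics.QuantumManyBody.BoseGas.IsRepulsiveFiniteRange v → ∃ ρ₀ : ℝ, 0 < ρ₀ ∧ ∀ ρ : ℝ, 0 < ρ → ρ < ρ₀ → ∃ C : ℝ, ∀ᶠ N : ℕ in Filter.atTop, ∀ i : Fin N, ∀ δ : ENNReal, 0 < δ → ∃ Ψ : Literature.MathematicalPhysics.QuantumManyBody.BoseGas.TrialState N (Literature.MathematicalPhysics.QuantumManyBody.BoseGas.sideLength ρ N), Literature.MathematicalPhysics.QuantumManyBody.BoseGas.energy v Ψ ≤ Literature.MathematicalPhysics.QuantumManyBody.BoseGas.groundStateEnergy v N (Literature.MathematicalPhysics.QuantumManyBody.BoseGas.sideLength ρ N) +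 δ ∧ (∀ X, Ψ.ψ X = (‖Ψ.ψ X‖ : ℂ)) ∧ (let p : Literature.MathematicalPhysics.QuantumManyBody.BoseGas.Config N × Literature.MathematicalPhysics.QuantumManyBody.BoseGas.Config N → ℝ := fun Z => ‖Ψ.ψ Z.1‖ ^ 2 * ‖Ψ.ψ Z.2‖ ^ 2; let q : Literature.MathematicalPhysics.QuantumManyBody.BoseGas.Config N × Literature.MathematicalPhysics.QuantumManyBody.BoseGas.Config N → ℝ := fun Z => ‖Ψ.ψ (Function.update Z.1 i (Z.2 i))‖ ^ 2 * ‖Ψ.ψ (Function.update Z.2 i (Z.1 i))‖ ^ 2; (1 / 2 : ENNReal) ≤ (∫⁻ Z in {Z | q Z ≠ 0}, ENNReal.ofReal (p Z)) ∧ (∫⁻ Z in {Z | q Z ≠ 0}, ENNReal.ofReal (p Z * (Real.log (p Z) - Real.log (q Z)))) ≤ ENNReal.ofReal C)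

/-- item stmt-AtomisticToContinuum-3977 · crux · rank 2 · closed · moot by None · by planner
why it might fail: Needs log Ψ₀ to respond LINEARLY to long-wavelength density waves with a C/|k| symbol and a summable remainder; genuine many-body (three-phonon, marginal in 3+1 D) terms of the insertion field could carry extra IR weight — the Reatto–Chester 1/r² tail is heuristic.
sources: ReattoChester1967, Reatto1969, Chester1970, GirvinMacdonald1987, Literature.Barriers.AtomisticToContinuum.BogoliubovPerturbationInfrared, Griffin1993
[crux] (crux R of the card + the variance bookkeeping, typed as one implication so that all three
cruxes talk about the same witness) For v, small ρ and ANY constants C_H, C_L there is C such that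
for large N, every i and every δ > 0: IF every δ-near-minimiser is C_H-hyperuniform in the window
2π/L ≤ |k| ≤ √(ρa) (body of GroundStateHyperuniformity) AND some nonnegative δ-near-minimiser has
accessible one-variable log-oscillation ≤ C_L at displacement scale ξ = (ρa)^{−1/2} (body of
LocalLogHarnack), THEN some nonnegative δ-near-minimiser has accessible mass ≥ 1/2 and accessible
swap entropy ≤ C (body of InsertionEntropyBound). Intended proof: D_acc ≤ E_X̂[⟨U⟩_n,acc −
⟨U⟩_{p_X̂}] = ∫₀¹ E Var_{p_t}(U) dt; split Var at scale ξ; UV part from the L-hypothesis; IR part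
Σ_{|k|≤1/ξ} |Û_X̂(k)|² with the LINEAR-RESPONSE STRUCTURE Û_X̂(k) = ĥ(k)ρ̂_X̂(k) + r_X̂(k), |ĥ(k)| ≤
C/|k|, E|r|² summable, so that E Σ|ĥ|²|ρ̂|²/V² ≤ (C_H/ρ)∫_{|k|≤√(ρa)} k^{-2}·k/√(ρa) d³k = O(C_H
√(ρa³)·const): the k^{d−2} integrand. [deps: GroundStateHyperuniformity, LocalLogHarnack]
[difficulty: XL] -/
@[route_item "route-AtomisticToContinuum-BECSwapAffinity"]
def InsertionEntropyFromStructure : Prop :=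
  ∀ v : ℝ → ENNReal, Literature.MathematicalPhysics.QuantumManyBody.BoseGas.IsRepulsiveFiniteRange v → ∃ ρ₀ : ℝ, 0 < ρ₀ ∧ ∀ ρ : ℝ, 0 < ρ → ρ < ρ₀ → ∀ C_H C_L : ℝ, ∃ C : ℝ, ∀ᶠ N : ℕ in Filter.atTop, ∀ i : Fin N, ∀ δ : ENNReal, 0 < δ → (∀ Ψ : Literature.MathematicalPhysics.QuantumManyBody.BoseGas.TrialState N (Literature.MathematicalPhysics.QuantumManyBody.BoseGas.sideLength ρ N), Literature.MathematicalPhysics.QuantumManyBody.BoseGas.energy v Ψ ≤ Literature.MathematicalPhysics.QuantumManyBody.BoseGas.groundStateEnergy v N (Literature.MathematicalPhysics.QuantumManyBody.BoseGas.sideLength ρ N) + δ → (∀ m : Fin 3 → ℤ, m ≠ 0 → let L : ℝ := Literature.MathematicalPhysics.QuantumManyBody.BoseGas.sideLength ρ N; let a : ℝ := (Literature.MathematicalPhysics.QuantumManyBody.BoseGas.scatteringLength v).toReal; let k : ℝ := 2 * Real.pi / L * ‖(WithLp.toLp 2 fun t => (m t : ℝ) : EuclideanSpace ℝ (Fin 3))‖;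 k ≤ Real.sqrt (ρ * a) → (⨅ c : ℂ, ∫⁻ X, (‖(∑ j : Fin N, Complex.exp (Complex.I * ↑(2 * Real.pi / L * ∑ t : Fin 3, (m t : ℝ) * X j t))) - c‖₊ : ENNReal) ^ 2 * (‖Ψ.ψ X‖₊ : ENNReal) ^ 2) ≤ ENNReal.ofReal (C_H * N * k / Real.sqrt (ρ * a)))) → (∃ Ψ : Literature.MathematicalPhysics.QuantumManyBody.BoseGas.TrialState N (Literature.MathematicalPhysics.QuantumManyBody.BoseGas.sideLength ρ N), Literature.MathematicalPhysics.QuantumManyBody.BoseGas.energy v Ψ ≤ Literature.MathematicalPhysics.QuantumManyBody.BoseGas.groundStateEnergy v N (Literature.MathematicalPhysics.QuantumManyBody.BoseGas.sideLength ρ N) + δ ∧ (∀ X, Ψ.ψ X = (‖Ψ.ψ X‖ : ℂ)) ∧ (let r : ℝ := (Real.sqrt (ρ * (Literature.MathematicalPhysics.QuantumManyBody.BoseGas.scatteringLength v).toReal))⁻¹; let B : Set (EuclideanSpace ℝ (Fin 3)) := Metric.ball 0 r; let Φ : Literature.MathematicalPhysics.QuantumManyBody.BoseGas.Config N × EuclideanSpace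 ℝ (Fin 3) → ℂ := fun W => Ψ.ψ (Function.update W.1 i (W.1 i + W.2)); (∫⁻ W in {W | W.2 ∈ B ∧ Φ W = 0}, (‖Ψ.ψ W.1‖₊ : ENNReal) ^ 2) ≤ 4⁻¹ * MeasureTheory.volume B ∧ (∫⁻ W in {W | W.2 ∈ B ∧ Φ W ≠ 0}, ENNReal.ofReal |Real.log (‖Ψ.ψ W.1‖ ^ 2) - Real.log (‖Φ W‖ ^ 2)| * (‖Ψ.ψ W.1‖₊ : ENNReal) ^ 2) ≤ ENNReal.ofReal C_L * MeasureTheory.volume B)) → ∃ Ψ : Literature.MathematicalPhysics.QuantumManyBody.BoseGas.TrialState N (Literature.MathematicalPhysics.QuantumManyBody.BoseGas.sideLength ρ N), Literature.MathematicalPhysics.QuantumManyBody.BoseGas.energy v Ψ ≤ Literature.MathematicalPhysics.QuantumManyBody.BoseGas.groundStateEnergy v N (Literature.MathematicalPhysics.QuantumManyBody.BoseGas.sideLength ρ N) + δ ∧ (∀ X, Ψ.ψ X = (‖Ψ.ψ X‖ : ℂ)) ∧ (let p : Literature.MathematicalPhysics.QuantumManyBody.BoseGas.Config N × Literature.MathematicalPhysics.QuantumManyBody.BoseGas.Config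 N → ℝ := fun Z => ‖Ψ.ψ Z.1‖ ^ 2 * ‖Ψ.ψ Z.2‖ ^ 2; let q : Literature.MathematicalPhysics.QuantumManyBody.BoseGas.Config N × Literature.MathematicalPhysics.QuantumManyBody.BoseGas.Config N → ℝ := fun Z => ‖Ψ.ψ (Function.update Z.1 i (Z.2 i))‖ ^ 2 * ‖Ψ.ψ (Function.update Z.2 i (Z.1 i))‖ ^ 2; (1 / 2 : ENNReal) ≤ (∫⁻ Z in {Z | q Z ≠ 0}, ENNReal.ofReal (p Z)) ∧ (∫⁻ Z in {Z | q Z ≠ 0}, ENNReal.ofReal (p Z * (Real.log (p Z) - Real.log (q Z)))) ≤ ENNReal.ofReal C)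

/-- item stmt-AtomisticToContinuum-3978 · crux · rank 3 · closed · moot by None · by planner
why it might fail: Uniformity down to |k| = 2π/L in a DIRICHLET box for all near-minimisers rests on a static-response energy lower bound at LHY precision with a cos-probe that is not in print; wall layers / the canonical constraint could spoil the lowest modes; C might need ρ-dependence.
sources: PitaevskiiStringari1991, FournaisSolovej2020, Fournais2020, TorquatoStillinger2003, LSSY2005, Literature.Barriers.AtomisticToContinuum.KineticGapLengthScales
[crux] (crux H) For every repulsive finite-range v there are ρ₀, C such that for 0 < ρ < ρ₀ and all
large N there is δ > 0 with: every δ-near-minimiser Ψ (Dirichlet, L = (N/ρ)^{1/3}, complex allowed —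
the functional is |Ψ|²-robust) has, for every k = (2π/L)m, m ∈ ℤ³∖0 with |k| ≤ √(ρa) (a = scattering
length; empty window for v ≡ 0), Var_{|Ψ|²}(Σ_j e^{ik·x_j}) ≤ C·N·|k|/√(ρa), i.e. S_N(k) ≤
C|k|/√(ρa) uniformly down to the lowest mode (Bogoliubov: S = k/√(k²+16πρa), C → 1/(4√π)). Route to
it: Onsager–Price/Pitaevskii–Stringari Schwarz inequality S(k) ≤ |k|√(χ_N(k)/N) for near-minimisers
plus a static-response bound χ_N(k)/N ≤ C'/(ρa) from a second-order (LHY-precision, inhomogeneous)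
energy LOWER bound for H_N + λΣ_i cos(k·x_i). [difficulty: XL] -/
@[route_item "route-AtomisticToContinuum-BECSwapAffinity"]
def GroundStateHyperuniformity : Prop :=
  ∀ v : ℝ → ENNReal, Literature.MathematicalPhysics.QuantumManyBody.BoseGas.IsRepulsiveFiniteRange v → ∃ ρ₀ C : ℝ, 0 < ρ₀ ∧ ∀ ρ : ℝ, 0 < ρ → ρ < ρ₀ → ∀ᶠ N : ℕ in Filter.atTop, ∃ δ : ENNReal, 0 < δ ∧ ∀ Ψ : Literature.MathematicalPhysics.QuantumManyBody.BoseGas.TrialState N (Literature.MathematicalPhysics.QuantumManyBody.BoseGas.sideLength ρ N), Literature.MathematicalPhysics.QuantumManyBody.BoseGas.energy v Ψ ≤ Literature.MathematicalPhysics.QuantumManyBody.BoseGas.groundStateEnergy v N (Literature.MathematicalPhysics.QuantumManyBody.BoseGas.sideLength ρ N) + δ → (∀ m : Fin 3 → ℤ, m ≠ 0 → let L : ℝ := Literature.MathematicalPhysics.QuantumManyBody.BoseGas.sideLength ρ N; let a : ℝ := (Literature.MathematicalPhysics.QuantumManyBody.BoseGas.scatteringLength v).toReal; let k : ℝ :=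 2 * Real.pi / L * ‖(WithLp.toLp 2 fun t => (m t : ℝ) : EuclideanSpace ℝ (Fin 3))‖; k ≤ Real.sqrt (ρ * a) → (⨅ c : ℂ, ∫⁻ X, (‖(∑ j : Fin N, Complex.exp (Complex.I * ↑(2 * Real.pi / L * ∑ t : Fin 3, (m t : ℝ) * X j t))) - c‖₊ : ENNReal) ^ 2 * (‖Ψ.ψ X‖₊ : ENNReal) ^ 2) ≤ ENNReal.ofReal (C * N * k / Real.sqrt (ρ * a)))

/-- item stmt-AtomisticToContinuum-3979 · crux · rank 4 · closed · moot by None · by planner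
why it might fail: The first moment of the one-variable log-oscillation at scale ξ must be O(1) uniformly in N although ~(ρa³)^(−1/2) neighbours lie within ξ; near-wall and near-core log-singularities must stay integrable; the tagged-particle coupling argument is heuristic.
sources: ReedSimonIV1978, Reatto1969, ReattoChester1967, LiebSeiringerSolovejYngvason2005, McMillan1965
[crux] (crux L) For every repulsive finite-range v there are ρ₀, C such that for 0 < ρ < ρ₀, all
large N, every i and every δ > 0 some nonnegative δ-near-minimiser Ψ satisfies, with r =
(ρa)^{−1/2}, B = ball(0,r) and X^{i,h} = X with x_i ↦ x_i + h: (a) inaccessible displaced mass ∫_B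
P_{X∼Ψ²}(Ψ(X^{i,h}) = 0) dh ≤ |B|/4 and (b) accessible log-oscillation ∫_B E_{X∼Ψ²}[|log Ψ²(X) − log
Ψ²(X^{i,h})|; Ψ(X^{i,h}) ≠ 0] dh ≤ C|B| — one-variable log-Harnack at the healing scale, μ-typically
and in first moment (not pointwise: ~(ρa³)^{−1/2} neighbours sit within ξ, but only fluctuations of
Σ_j u(x−x_j) enter, of variance O(√(ρa³))). Intended proof: Feynman–Kac / ground-state-transformed
diffusion of the tagged particle over time ξ², coupling; or Moser–Harnack for the one-variable
conditional amplitude with the frozen environment as a potential. [difficulty: L] -/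
@[route_item "route-AtomisticToContinuum-BECSwapAffinity"]
def LocalLogHarnack : Prop :=
  ∀ v : ℝ → ENNReal, Literature.MathematicalPhysics.QuantumManyBody.BoseGas.IsRepulsiveFiniteRange v → ∃ ρ₀ C : ℝ, 0 < ρ₀ ∧ ∀ ρ : ℝ, 0 < ρ → ρ < ρ₀ → ∀ᶠ N : ℕ in Filter.atTop, ∀ i : Fin N, ∀ δ : ENNReal, 0 < δ → ∃ Ψ : Literature.MathematicalPhysics.QuantumManyBody.BoseGas.TrialState N (Literature.MathematicalPhysics.QuantumManyBody.BoseGas.sideLength ρ N), Literature.MathematicalPhysics.QuantumManyBody.BoseGas.energy v Ψ ≤ Literature.MathematicalPhysics.QuantumManyBody.BoseGas.groundStateEnergy v N (Literature.MathematicalPhysics.QuantumManyBody.BoseGas.sideLength ρ N) + δ ∧ (∀ X, Ψ.ψ X = (‖Ψ.ψ X‖ : ℂ)) ∧ (let r : ℝ := (Real.sqrt (ρ * (Literature.MathematicalPhysics.QuantumManyBody.BoseGas.scatteringLength v).toReal))⁻¹; let B : Set (EuclideanSpace ℝ (Fin 3)) := Metric.ball 0 r; let Φ : Literature.MathematicalPhysics.QuantumManyBody.BoseGas.Config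 N × EuclideanSpace ℝ (Fin 3) → ℂ := fun W => Ψ.ψ (Function.update W.1 i (W.1 i + W.2)); (∫⁻ W in {W | W.2 ∈ B ∧ Φ W = 0}, (‖Ψ.ψ W.1‖₊ : ENNReal) ^ 2) ≤ 4⁻¹ * MeasureTheory.volume B ∧ (∫⁻ W in {W | W.2 ∈ B ∧ Φ W ≠ 0}, ENNReal.ofReal |Real.log (‖Ψ.ψ W.1‖ ^ 2) - Real.log (‖Φ W‖ ^ 2)| * (‖Ψ.ψ W.1‖₊ : ENNReal) ^ 2) ≤ ENNReal.ofReal C * MeasureTheory.volume B)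

/-- item stmt-AtomisticToContinuum-3298 · crux · rank 5 · closed · moot by None · by planner
why it might fail: Needs a UNIQUE ground state at fixed N: automatic for finite v (positivity improving), but for hard cores the N-sphere free region in Λ_L is disconnected for large L (sparse locally jammed packings exist at any density), so caged components must be excluded by an energy argument.
sources: ReedSimonIV1978, BaryshnikovBubenikKahle2013, Kahle2012, LiebSeiringerSolovejYngvason2005, route-AtomisticToContinuum-BECPalmLandscape
[crux] card item A2 (phase rigidity): ∀ admissible v ∃ρ₀ ∀ρ<ρ₀ ∀ᶠ N ∀η>0 ∃δ>0: any two
δ-near-minimisers Ψ, Φ ∈ TrialState N L (L = (N/ρ)^(1/3)) satisfy ∫|Ψ − cΦ|² ≤ η for some unit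
complex c (E₀ < ∞, compact resolvent, unique positive ground state and spectral gap of the Dirichlet
N-body problem at fixed N; for hard cores via connectedness / energetic dominance of the dilute
component of the hard-sphere configuration space). [difficulty: M] -/
@[route_item "route-AtomisticToContinuum-BECSwapAffinity"]
def GroundStateRigidity : Prop :=
  ∀ v : ℝ → ENNReal, Literature.MathematicalPhysics.QuantumManyBody.BoseGas.IsRepulsiveFiniteRange v → ∃ ρ₀ : ℝ, 0 < ρ₀ ∧ ∀ ρ : ℝ, 0 < ρ → ρ < ρ₀ → ∀ᶠ N : ℕ in Filter.atTop, ∀ η : ℝ, 0 < η → ∃ δ : ENNReal, 0 < δ ∧ ∀ Ψ Φ : Literature.MathematicalPhysics.QuantumManyBody.BoseGas.TrialState N (Literature.MathematicalPhysics.QuantumManyBody.BoseGas.sideLength ρ N), Literature.MathematicalPhysics.QuantumManyBody.BoseGas.energy v Ψ ≤ Literature.MathematicalPhysics.QuantumManyBody.BoseGas.groundStateEnergy v N (Literature.MathematicalPhysics.QuantumManyBody.BoseGas.sideLength ρ N) + δ → Literature.MathematicalPhysics.QuantumManyBody.BoseGas.energy v Φ ≤ Literature.MathematicalPhysics.QuantumManyBody.BoseGas.groundStateEnergy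 v N (Literature.MathematicalPhysics.QuantumManyBody.BoseGas.sideLength ρ N) + δ → ∃ c : ℂ, ‖c‖ = 1 ∧ ∫⁻ X, (‖Ψ.ψ X - c * Φ.ψ X‖₊ : ENNReal) ^ 2 ≤ ENNReal.ofReal η

/-- item stmt-AtomisticToContinuum-0850 · support · rank 9 · closed · moot by None · by planner
sources: LiebSeiringerSolovejYngvason2005
[support] GroundStateEnergyFinite: for repulsive finite-range v (range R₀) there is ρ₀>0 (ρ₀ < R₀⁻³
works) such that for ρ<ρ₀ and all large N the Dirichlet ground-state energy groundStateEnergy v N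
((N/ρ)^{1/3}) is finite: exhibit one symmetric C¹ trial state made of N disjoint bumps at mutual
distance > R₀ (interaction_eq_zero_of_lt_dist), finite kinetic energy. Hypothesis of the Assembly
(needed to subtract in ℝ≥0∞). [folklore; LiebSeiringerSolovejYngvason2005 (2.3)] -/
@[route_item "route-AtomisticToContinuum-BECSwapAffinity"]
def GroundStateEnergyFinite : Prop :=
  ∀ v : ℝ → ENNReal, Literature.MathematicalPhysics.QuantumManyBody.BoseGas.IsRepulsiveFiniteRange v → ∃ ρ₀ : ℝ, 0 < ρ₀ ∧ ∀ ρ : ℝ, 0 < ρ → ρ < ρ₀ → ∀ᶠ N : ℕ in Filter.atTop, Literature.MathematicalPhysics.QuantumManyBody.BoseGas.groundStateEnergy v N (Literature.MathematicalPhysics.QuantumManyBody.BoseGas.sideLength ρ N) ≠ ⊤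

/-- item stmt-AtomisticToContinuum-3980 · support · rank 9 · closed · refuted by Summit.AtomisticToContinuum.BoseEinsteinCondensation.Theorems.BECSwapAffinitySwapJensen_refuted (refuter) · by planner
sources: PenroseOnsager1956, HerdmanEtAl2014
[support] (identity + truncated Jensen, card item 1) For every real nonnegative trial state Ψ of N =
n+1 bosons, θ > 0 and C: if the accessible mass at coordinate 0 is ≥ θ and the accessible swap
entropy is ≤ C then the swap purity ∫∫ |∫Ψ(x,X̂)Ψ(x,Ŷ)dx|² dX̂dŶ (= tr γ²/N² = ∫√(pq)) is ≥
θ·exp(−C/(2θ)). Proof: ∫√(pq) = E_P[√(q/p); G], Jensen for log on the conditional law P(·|G), log⁺ ≥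
log, monotonicity of M ↦ M e^(−D/(2M)); Tonelli to identify the K-form with ∫√(pq) (Matrix.vecCons ↔
Function.update at 0). [difficulty: M] -/
@[route_item "route-AtomisticToContinuum-BECSwapAffinity"]
def SwapJensen : Prop :=
  ∀ n : ℕ, ∀ L : ℝ, ∀ Ψ : Literature.MathematicalPhysics.QuantumManyBody.BoseGas.TrialState (n + 1) L, (∀ X, Ψ.ψ X = (‖Ψ.ψ X‖ : ℂ)) → ∀ θ C : ℝ, 0 < θ → let p : Literature.MathematicalPhysics.QuantumManyBody.BoseGas.Config (n + 1) × Literature.MathematicalPhysics.QuantumManyBody.BoseGas.Config (n + 1) → ℝ := fun Z => ‖Ψ.ψ Z.1‖ ^ 2 * ‖Ψ.ψ Z.2‖ ^ 2; let q : Literature.MathematicalPhysics.QuantumManyBody.BoseGas.Config (n + 1) × Literature.MathematicalPhysics.QuantumManyBody.BoseGas.Config (n + 1) → ℝ := fun Z => ‖Ψ.ψ (Function.update Z.1 0 (Z.2 0))‖ ^ 2 * ‖Ψ.ψ (Function.update Z.2 0 (Z.1 0))‖ ^ 2; ENNReal.ofReal θ ≤ (∫⁻ Z in {Z | q Z ≠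 0}, ENNReal.ofReal (p Z)) → (∫⁻ Z in {Z | q Z ≠ 0}, ENNReal.ofReal (p Z * (Real.log (p Z) - Real.log (q Z)))) ≤ ENNReal.ofReal C → ENNReal.ofReal (θ * Real.exp (-(C / (2 * θ)))) ≤ ∫⁻ P : Literature.MathematicalPhysics.QuantumManyBody.BoseGas.Config n × Literature.MathematicalPhysics.QuantumManyBody.BoseGas.Config n, (‖∫ x, Ψ.ψ (Matrix.vecCons x P.1) * (starRingEnd ℂ) (Ψ.ψ (Matrix.vecCons x P.2))‖₊ : ENNReal) ^ 2

/-- item stmt-AtomisticToContinuum-3981 · support · rank 9 · closed · moot by None · by planner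
sources: PenroseOnsager1956, LSSY2005
[support] (Penrose–Onsager (5), variational form) For every trial state Ψ of n+1 bosons (complex
allowed): (n+1)·∫∫|∫Ψ(x,X̂)conjΨ(x,Ŷ)dx|² dX̂dŶ ≤ maxOccupation (n+1) Ψ, i.e. tr γ² ≤ N λ_max(γ).
Operator-free proof: with the normalised modes φ_Ŷ = Ψ(·,Ŷ)/‖Ψ(·,Ŷ)‖ and weights w(Ŷ) = ‖Ψ(·,Ŷ)‖²,
occupation N φ_Ŷ Ψ = N∫|K(X̂,Ŷ)|²dX̂ / w(Ŷ), and a w-average of occupations is ≤ their supremum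
(Tonelli; measurability of φ_Ŷ from continuity of Ψ). [difficulty: M] -/
@[route_item "route-AtomisticToContinuum-BECSwapAffinity"]
def TraceSqLower : Prop :=
  ∀ n : ℕ, ∀ L : ℝ, ∀ Ψ : Literature.MathematicalPhysics.QuantumManyBody.BoseGas.TrialState (n + 1) L, ((n + 1 : ℕ) : ENNReal) * (∫⁻ P : Literature.MathematicalPhysics.QuantumManyBody.BoseGas.Config n × Literature.MathematicalPhysics.QuantumManyBody.BoseGas.Config n, (‖∫ x, Ψ.ψ (Matrix.vecCons x P.1) * (starRingEnd ℂ) (Ψ.ψ (Matrix.vecCons x P.2))‖₊ : ENNReal) ^ 2) ≤ Literature.MathematicalPhysics.QuantumManyBody.BoseGas.maxOccupation (n + 1) Ψ.ψ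

/-- item stmt-AtomisticToContinuum-3982 · support · rank 9 · closed · moot by None · by planner
sources: PenroseOnsager1956, LiebSeiringerSolovejYngvason2005
[support] (mode-free frame, shared with cards swap-overlap-no-catastrophe S2 / rigidity-tolerance
X_C) If for every v, small ρ, some c > 0, all large n some δ > 0 makes every δ-near-minimiser of n+1
bosons have swap purity ≥ c, then BoseEinsteinCondensation. Proof: TraceSqLower gives maxOccupation
≥ c(n+1); le_condensateNumber; index shift N = n+1. [difficulty: S] -/
@[route_item "route-AtomisticToContinuum-BECSwapAffinity"]
def SwapPurityImpliesBEC : Prop :=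
  (∀ v : ℝ → ENNReal, Literature.MathematicalPhysics.QuantumManyBody.BoseGas.IsRepulsiveFiniteRange v → ∃ ρ₀ : ℝ, 0 < ρ₀ ∧ ∀ ρ : ℝ, 0 < ρ → ρ < ρ₀ → ∃ c : ℝ, 0 < c ∧ ∀ᶠ n : ℕ in Filter.atTop, ∃ δ : ENNReal, 0 < δ ∧ ∀ Ψ : Literature.MathematicalPhysics.QuantumManyBody.BoseGas.TrialState (n + 1) (Literature.MathematicalPhysics.QuantumManyBody.BoseGas.sideLength ρ (n + 1)), Literature.MathematicalPhysics.QuantumManyBody.BoseGas.energy v Ψ ≤ Literature.MathematicalPhysics.QuantumManyBody.BoseGas.groundStateEnergy v (n + 1) (Literature.MathematicalPhysics.QuantumManyBody.BoseGas.sideLength ρ (n + 1)) + δ → ENNReal.ofReal c ≤ ∫⁻ P : Literature.MathematicalPhysics.QuantumManyBody.BoseGas.Config n × Literature.MathematicalPhysics.QuantumManyBody.BoseGas.Config n, (‖∫ x, Ψ.ψ (Matrix.vecCons x P.1) * (starRingEnd ℂ) (Ψ.ψ (Matrix.vecCons x P.2))‖₊ : ENNReal) ^ 2) → Literature.Ma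thematicalPhysics.QuantumManyBody.BoseGas.BoseEinsteinCondensation

/-- item stmt-AtomisticToContinuum-3983 · support · rank 9 · closed · moot by None · by planner
sources: PenroseOnsager1956, LiebSeiringerSolovejYngvason2005
[support] (frame #1: X_A → statement, given the transfer) InsertionEntropyBound →
GroundStateRigidity → BoseEinsteinCondensation. Proof: for N = n+1 large and every δ the target
witness has purity ≥ ½e^(−C) (SwapJensen with θ = 1/2, i = 0), hence maxOccupation ≥ (N/2)e^(−C)
(TraceSqLower); NearMinimiserStability (from GroundStateRigidity) gives δ₀ with maxOccupation ≥
(N/4)e^(−C) for all δ₀-near-minimisers; le_condensateNumber; c = e^(−C)/4. The planner's Sketch.lean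
proves GroundStateHyperuniformity → LocalLogHarnack → InsertionEntropyFromStructure →
InsertionEntropyBound by pure logic (δ' = min δ δ_H), so this item plus that lemma is the Assembly.
[difficulty: S] -/
@[route_item "route-AtomisticToContinuum-BECSwapAffinity"]
def TargetToBEC : Prop :=
  InsertionEntropyBound → GroundStateRigidity → Literature.MathematicalPhysics.QuantumManyBody.BoseGas.BoseEinsteinCondensation

/-- item stmt-AtomisticToContinuum-3984 · support · rank 9 · closed · moot by None · by planner
sources: LiebSeiringerSolovejYngvason2005, route-AtomisticToContinuum-BECPalmLandscape
[support] (the form of the transfer the frame uses) GroundStateRigidity → for every v, small ρ and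
all large N: if for every δ > 0 SOME δ-near-minimiser has maxOccupation ≥ m, then for some δ > 0
EVERY δ-near-minimiser has maxOccupation ≥ m/2. Proof from rigidity with η ~ (m/(8N))² and the
√N-Lipschitz bound maxOccupation(Ψ)^(1/2) ≤ maxOccupation(Φ)^(1/2) + √N‖Ψ − cΦ‖₂ (sup over modes of
item stmt-AtomisticToContinuum-3300 OccupationStability of route BECPalmLandscape); m ≤ N is forced
by the hypothesis. [difficulty: provable-now] -/
@[route_item "route-AtomisticToContinuum-BECSwapAffinity"]
def NearMinimiserStability : Prop :=
  GroundStateRigidity → (∀ v : ℝ → ENNReal, Literature.MathematicalPhysics.QuantumManyBody.BoseGas.IsRepulsiveFiniteRange v → ∃ ρ₀ : ℝ, 0 < ρ₀ ∧ ∀ ρ : ℝ, 0 < ρ → ρ < ρ₀ → ∀ᶠ N : ℕ in Filter.atTop, ∀ m : ENNReal, (∀ δ : ENNReal, 0 < δ → ∃ Ψ : Literature.MathematicalPhysics.QuantumManyBody.BoseGas.TrialState N (Literature.MathematicalPhysics.QuantumManyBody.BoseGas.sideLength ρ N), Literature.MathematicalPhysics.QuantumManyBody.BoseGas.energy v Ψ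 ≤ Literature.MathematicalPhysics.QuantumManyBody.BoseGas.groundStateEnergy v N (Literature.MathematicalPhysics.QuantumManyBody.BoseGas.sideLength ρ N) + δ ∧ m ≤ Literature.MathematicalPhysics.QuantumManyBody.BoseGas.maxOccupation N Ψ.ψ) → ∃ δ : ENNReal, 0 < δ ∧ ∀ Ψ : Literature.MathematicalPhysics.QuantumManyBody.BoseGas.TrialState N (Literature.MathematicalPhysics.QuantumManyBody.BoseGas.sideLength ρ N), Literature.MathematicalPhysics.QuantumManyBody.BoseGas.energy v Ψ ≤ Literature.MathematicalPhysics.QuantumManyBody.BoseGas.groundStateEnergy v N (Literature.MathematicalPhysics.QuantumManyBody.BoseGas.sideLength ρ N) + δ → m / 2 ≤ Literature.MathematicalPhysics.QuantumManyBody.BoseGas.maxOccupation N Ψ.ψ)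

/-- item stmt-AtomisticToContinuum-3985 · support · rank 9 · closed · moot by None · by planner
sources: PenroseOnsager1956, LiebSeiringerSolovejYngvason2005
[support] (negative side; certifies the existential typing of X_A) It is FALSE that for all v, small
ρ, some C, all large N, some δ > 0, EVERY nonnegative δ-near-minimiser has accessible mass ≥ 1/2 and
accessible swap entropy ≤ C. Witness v ≡ 0: multiply a nonnegative C¹ near-minimiser by flat pair
cut-offs Π_(i<j)(1 − χ_ε(x_i − x_j)) (χ_ε = 1 on a ball of radius ε, 1 − χ_ε vanishing to infinite
order at |x| = 2ε): the energy excess → 0 as ε → 0 at fixed N while p log⁺(p/q) is non-integrable at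
the artificial contact surface, so D_acc = ⊤ for near-minimisers of every slack. [difficulty: L] -/
@[route_item "route-AtomisticToContinuum-BECSwapAffinity"]
def UniversalEntropyBoundFails : Prop :=
  ¬ (∀ v : ℝ → ENNReal, Literature.MathematicalPhysics.QuantumManyBody.BoseGas.IsRepulsiveFiniteRange v → ∃ ρ₀ : ℝ, 0 < ρ₀ ∧ ∀ ρ : ℝ, 0 < ρ → ρ < ρ₀ → ∃ C : ℝ, ∀ᶠ N : ℕ in Filter.atTop, ∀ i : Fin N, ∃ δ : ENNReal, 0 < δ ∧ ∀ Ψ : Literature.MathematicalPhysics.QuantumManyBody.BoseGas.TrialState N (Literature.MathematicalPhysics.QuantumManyBody.BoseGas.sideLength ρ N), Literature.MathematicalPhysics.QuantumManyBody.BoseGas.energy v Ψ ≤ Literature.MathematicalPhysics.QuantumManyBody.BoseGas.groundStateEnergy v N (Literature.MathematicalPhysics.QuantumManyBody.BoseGas.sideLength ρ N) + δ → (∀ X, Ψ.ψ X = (‖Ψ.ψ X‖ : ℂ)) → (let p : Literature.MathematicalPhysics.QuantumManyBody.BoseGas.Config N × Literature.MathematicalPhysics.QuantumManyBody.BoseGas.Config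 N → ℝ := fun Z => ‖Ψ.ψ Z.1‖ ^ 2 * ‖Ψ.ψ Z.2‖ ^ 2; let q : Literature.MathematicalPhysics.QuantumManyBody.BoseGas.Config N × Literature.MathematicalPhysics.QuantumManyBody.BoseGas.Config N → ℝ := fun Z => ‖Ψ.ψ (Function.update Z.1 i (Z.2 i))‖ ^ 2 * ‖Ψ.ψ (Function.update Z.2 i (Z.1 i))‖ ^ 2; (1 / 2 : ENNReal) ≤ (∫⁻ Z in {Z | q Z ≠ 0}, ENNReal.ofReal (p Z)) ∧ (∫⁻ Z in {Z | q Z ≠ 0}, ENNReal.ofReal (p Z * (Real.log (p Z) - Real.log (q Z)))) ≤ ENNReal.ofReal C))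

/-- item stmt-AtomisticToContinuum-3986 · assembly · rank 1 · closed · moot by None · by planner
sources: PenroseOnsager1956, LiebSeiringerSolovejYngvason2005
[assembly] GroundStateHyperuniformity → LocalLogHarnack → InsertionEntropyFromStructure →
GroundStateRigidity → BoseEinsteinCondensation -/
@[route_item "route-AtomisticToContinuum-BECSwapAffinity"]
def Assembly : Prop :=
  GroundStateHyperuniformity → LocalLogHarnack → InsertionEntropyFromStructure → GroundStateRigidity → Literature.MathematicalPhysics.QuantumManyBody.BoseGas.BoseEinsteinCondensation

end Summit.AtomisticToContinuum.BoseEinsteinCondensation.Theses.BECSwapAffinity
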